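import Summits.CriticalPhenomena.PercolationContinuityZ3.Theorems.PercNearOneGluingNoHeavyLowerTailSahiCombMeetAbsorbing
import Summits.CriticalPhenomena.PercolationContinuityZ3.Theorems.PercNearOneGluingNoHeavyLowerTailSahiCombVennThree
import Summits.CriticalPhenomena.PercolationContinuityZ3.Theorems.PercNearOneGluingNoHeavyLowerTailSahiCombJunta

/-!
# The comb (tensor-Bernstein) hierarchy for Sahi's `E_k`, XVII: RANGE LIFTING — over a fixed finite set of events the whole
# hierarchy is carried by its INJECTIVE rows; over THREE events it collapses to the single cubic row (every order, unconditionally)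

Support file of the one-cut programme (crux `NoHeavyLowerTail`, stmt-CriticalPhenomena-4575; cell `prim-masterthm`, seat P3, gen 4;
`run/shared/lean/prim/prim-masterthm/prim-masterthm-p3/HIERARCHY.md` §11).  Vocabulary: `SahiComb.CombPos` (`…SahiCombPositivity`), the local
total-meet rung `combPos_sahiE_ind_of_totalMeet_local` (`…SahiCombMeetAbsorbing`).

THE POINT.  Sahi's conjecture is a statement about MULTISETS of events: `E_n(U_0,…,U_{n−1})` with repetitions allowed.  A repeated
member `U_a = U_b` contains the intersection of all the other members, so the total-meet rung (defect expansion, seat P5 /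
`…SahiCombStrata` R7′) expresses `E_n(U)` as a nonnegative combination of products of defect moments and `E_j`'s of PROPER
sub-families.  By strong induction on `n`:

* **`combPos_sahiE_ind_of_injective_subfamilies`** — RANGE LIFTING: if every INJECTIVE sub-family (pairwise distinct events, along an
  injection of slots) of size `j ≥ 3` has `E_j` comb-positive at multidegree `j`, then `E_n(U)` is comb-positive at multidegree `n`
  (increasing events; sizes `≤ 2` are (M⁺-2), `masterFamilyCombPos_two`).  So at the comb level, exactly as for the orders, the
  MULTIPLICITIES of Sahi's conjecture are free: (M⁺-k) for all `k ≤ r` on the injective `k`-sub-families of `r` given events gives every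
  order on every family drawn from them (`combPos_sahiE_ind_of_range`).
* **`combPos_sahiE_ind_of_range_three`**, **`combPos_sahiE_ind_iff_of_three`** — THREE EVENTS: for increasing `V_0, V_1, V_2` and every
  family `U` with values in `{V_0, V_1, V_2}` (any order `n`, any multiplicities), `E_n(U)` is comb-positive as soon as the single cubic
  row `E_3(1_{V_0},1_{V_1},1_{V_2})` is; i.e. over three events the comb hierarchy (all orders) is EQUIVALENT to its cubic row
  (the sub-triples with a repetition are nested, the distinct ones are permutations of the row — `sahiE_comp_perm`).
  Compare seat P2's law-level `M4.sahiPositive_iff_two_and_row` (on the lattice `M_4`, every weight: all orders ⟺ pairs ∧ one row).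
* `combPos_sahiE_ind_of_range_four` — FOUR EVENTS: all orders from the quartic row and the four cubic rows.
* UNCONDITIONAL ALL-ORDER ROWS (standard axioms), by feeding the proved cubic strata: every family drawn (with repetitions) from
  three UNIONS OF INDEPENDENT INCREASING EVENTS (`combPos_sahiE_ind_unions_three`, from `…SahiCombVennThree`), in particular from three
  OR-events of coordinates (`combPos_sahiE_ind_or_three`: `E_n ≥ 0` for `(1_{ω∩S_{s(j)}≠∅})_{j<n}`, every `n`, every `s : Fin n → Fin 3`);
  from a junta-intersection triple (`combPos_sahiE_ind_of_range_junta_three`, from prim-l12 P3's `…SahiCombJunta`); law-level shadows.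
HONEST FRAMING: nothing here asserts (M⁺-k) or `C_k` for `k ≥ 3` in general. [this work]
-/

noncomputable section

open scoped Classical

namespace Summit.CriticalPhenomena.PercolationContinuityZ3.Theorems

open Finset Function
open Literature.Combinatorics.Sahi2008
open Literature.Probability.Percolation (DeterminedBy)
open Literature.Probability.Percolation.DecisionTree (ind)
open SahiComb

variable {ι : Type} [Fintype ι]

namespace SahiCombRange

/-! ### Range lifting -/

omit [Fintype ι] in
/-- A repeated member contains the intersection of all the other members. [this work] -/
theorem iInter_succAbove_subset_of_eq {k : ℕ} (U : Fin (k + 3) → Set (Set ι)) {a b : Fin (k + 3)} (hab : a ≠ b)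
    (h : U a = U b) : (⋂ j, U (a.succAbove j)) ⊆ U a := by
  obtain ⟨j, hj⟩ := Fin.exists_succAbove_eq hab.symm
  intro ω hω
  have hωb := Set.mem_iInter.1 hω j
  rw [hj] at hωb
  rwa [h]

/-- **RANGE LIFTING (every order).**  Let `U_0,…,U_{n−1}` be increasing events.  If every INJECTIVE sub-family along an injection of
slots (`e : Fin j ↪ Fin n` with `l ↦ U (e l)` injective) of size `j ≥ 3` has `E_j` comb-positive at multidegree `j`, then `E_n(μ_p; 1_U)`
is comb-positive at multidegree `n`.  (A non-injective family has a repeated member, which contains the intersection of the others: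
local total-meet rung + strong induction; sizes `≤ 2` by (M⁺-2).) [this work] -/
theorem combPos_sahiE_ind_of_injective_subfamilies :
    ∀ (n : ℕ) (U : Fin n → Set (Set ι)), (∀ j, IsUpperSet (U j)) →
      (∀ (j : ℕ) (e : Fin j ↪ Fin n), 3 ≤ j → Function.Injective (fun l => U (e l)) →
        CombPos (fun _ : ι => j) (fun p => sahiE (bernoulliWeight p) j (fun l => ind (U (e l))))) →
      CombPos (fun _ : ι => n) (fun p => sahiE (bernoulliWeight p) n (fun j => ind (U j))) := by
  intro n
  induction n using Nat.strong_induction_on with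
  | _ n ih =>
    intro U hU hinj
    rcases Nat.lt_or_ge n 3 with hn3 | hn3
    · exact masterFamilyCombPos_of_le_two (by omega) ι U hU
    · obtain ⟨k, rfl⟩ : ∃ k, n = k + 3 := ⟨n - 3, by omega⟩
      by_cases hI : Function.Injective U
      · exact (hinj (k + 3) (Function.Embedding.refl _) (by omega) hI).congr fun p => rfl
      · obtain ⟨a, b, hUab, hab⟩ := Function.not_injective_iff.1 hI
        exact combPos_sahiE_ind_of_totalMeet_local U a (iInter_succAbove_subset_of_eq U hab hUab) fun j e hj =>
          ih j (by omega) (fun l => U (e l)) (fun l => hU _) fun j' e' hj' hinj' =>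
            hinj j' (e'.trans e) hj' hinj'

/-- **RANGE LIFTING, list form.**  If the increasing events `U_j` all occur in a list `V_0,…,V_{r−1}` and `E_j` is comb-positive for every
sub-family of `V` along an injection `Fin j ↪ Fin r` with `j ≥ 3`, then `E_n(μ_p; 1_U)` is comb-positive at multidegree `n`, for every `n`.
[this work] -/
theorem combPos_sahiE_ind_of_range {r n : ℕ} (V : Fin r → Set (Set ι)) (U : Fin n → Set (Set ι))
    (hU : ∀ j, IsUpperSet (U j)) (hrange : ∀ j, ∃ i, U j = V i)
    (hV : ∀ (j : ℕ) (φ : Fin j ↪ Fin r), 3 ≤ j →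
      CombPos (fun _ : ι => j) (fun p => sahiE (bernoulliWeight p) j (fun l => ind (V (φ l))))) :
    CombPos (fun _ : ι => n) (fun p => sahiE (bernoulliWeight p) n (fun j => ind (U j))) := by
  refine combPos_sahiE_ind_of_injective_subfamilies n U hU fun j e hj hinj => ?_
  choose g hg using hrange
  have hφ : Function.Injective (fun l => g (e l)) := fun a b hab => hinj (by
    show U (e a) = U (e b)
    rw [hg (e a), hg (e b)]
    exact congrArg V hab)
  refine (hV j ⟨_, hφ⟩ hj).congr fun p => ?_
  congr 1; funext l
  simp only [Function.Embedding.coeFn_mk, hg]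

/-- Sub-families of size `j ≥ 3` along an injection into `Fin 3` are permutations of the whole triple. [folklore] -/
theorem exists_perm_of_embedding_three {j : ℕ} (φ : Fin j ↪ Fin 3) (hj : 3 ≤ j) :
    ∃ (h : j = 3) (σ : Equiv.Perm (Fin 3)), ∀ l : Fin j, φ l = σ (Fin.cast h l) := by
  have hj3 : j = 3 := le_antisymm (by simpa using Fintype.card_le_of_embedding φ) hj
  subst hj3
  have hbij : Function.Bijective φ := Fintype.bijective_iff_injective_and_card φ |>.2 ⟨φ.injective, rfl⟩
  exact ⟨rfl, Equiv.ofBijective φ hbij, fun l => by simp⟩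

/-- **THREE EVENTS: the comb hierarchy is carried by the single cubic row.**  For increasing `V_0, V_1, V_2` with `E_3(1_{V_0},1_{V_1},1_{V_2})`
comb-positive at multidegree `3`, EVERY family `U` of events taken from `{V_0, V_1, V_2}` (any order `n`, any multiplicities, any
arrangement) has `E_n(μ_p; 1_U)` comb-positive at multidegree `n`. [this work] -/
theorem combPos_sahiE_ind_of_range_three {n : ℕ} (V : Fin 3 → Set (Set ι)) (hV : ∀ i, IsUpperSet (V i))
    (U : Fin n → Set (Set ι)) (hrange : ∀ j, ∃ i, U j = V i)
    (h3 : CombPos (fun _ : ι => 3) (fun p => sahiE (bernoulliWeight p) 3 (fun i => ind (V i)))) :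
    CombPos (fun _ : ι => n) (fun p => sahiE (bernoulliWeight p) n (fun j => ind (U j))) := by
  have hU : ∀ j, IsUpperSet (U j) := fun j => by
    obtain ⟨i, hi⟩ := hrange j
    rw [hi]; exact hV i
  refine combPos_sahiE_ind_of_range V U hU hrange fun j φ hj => ?_
  obtain ⟨rfl, σ, hσ⟩ := exists_perm_of_embedding_three φ hj
  refine h3.congr fun p => ?_
  rw [← sahiE_comp_perm (bernoulliWeight p) 3 σ (fun i => ind (V i))]
  congr 1; funext l
  simp only [hσ, Fin.cast_eq_self]

/-- **Over three events, all orders ⟺ the cubic row** (comb level, product measures): for increasing `V_0, V_1, V_2`,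
`E_n(μ_p; 1_{V∘s})` is comb-positive at multidegree `n` for every `n` and every `s : Fin n → Fin 3` if and only if `E_3(1_{V_0},1_{V_1},1_{V_2})`
is comb-positive at multidegree `3`. [this work] -/
theorem combPos_sahiE_ind_iff_of_three (V : Fin 3 → Set (Set ι)) (hV : ∀ i, IsUpperSet (V i)) :
    (∀ (n : ℕ) (s : Fin n → Fin 3), CombPos (fun _ : ι => n) (fun p => sahiE (bernoulliWeight p) n (fun j => ind (V (s j))))) ↔
      CombPos (fun _ : ι => 3) (fun p => sahiE (bernoulliWeight p) 3 (fun i => ind (V i))) :=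
  ⟨fun h => (h 3 id).congr fun _ => rfl,
    fun h3 _ s => combPos_sahiE_ind_of_range_three V hV (fun j => V (s j)) (fun j => ⟨s j, rfl⟩) h3⟩

/-- Law-level shadow: over three increasing events whose cubic row is comb-positive, Sahi's `E_n(μ_p) ≥ 0` for every family drawn from
them, every `n`, every product measure. [this work] -/
theorem sahiE_ind_nonneg_of_range_three {n : ℕ} (p : ι → unitInterval) (V : Fin 3 → Set (Set ι)) (hV : ∀ i, IsUpperSet (V i))
    (U : Fin n → Set (Set ι)) (hrange : ∀ j, ∃ i, U j = V i)
    (h3 : CombPos (fun _ : ι => 3) (fun p => sahiE (bernoulliWeight p) 3 (fun i => ind (V i)))) :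
    0 ≤ sahiE (bernoulliWeight p) n (fun j => ind (U j)) :=
  (combPos_sahiE_ind_of_range_three V hV U hrange h3).nonneg p

/-- Sub-families of size `j ≥ 3` along an injection into `Fin 4` have size `3` or are permutations of the whole quadruple. [folklore] -/
theorem embedding_four_cases {j : ℕ} (φ : Fin j ↪ Fin 4) (hj : 3 ≤ j) :
    j = 3 ∨ ∃ (h : j = 4) (σ : Equiv.Perm (Fin 4)), ∀ l : Fin j, φ l = σ (Fin.cast h l) := by
  have hj4 : j ≤ 4 := by simpa using Fintype.card_le_of_embedding φ
  rcases Nat.lt_or_ge j 4 with h | h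
  · exact Or.inl (by omega)
  · have hj4' : j = 4 := le_antisymm hj4 h
    subst hj4'
    have hbij : Function.Bijective φ := Fintype.bijective_iff_injective_and_card φ |>.2 ⟨φ.injective, rfl⟩
    exact Or.inr ⟨rfl, Equiv.ofBijective φ hbij, fun l => by simp⟩

/-- **FOUR EVENTS.**  For increasing `V_0,…,V_3`: if the quartic row `E_4(1_V)` and the cubic rows of all injective sub-triples
(`φ : Fin 3 ↪ Fin 4`) are comb-positive, then every family drawn from `{V_0,…,V_3}` has `E_n` comb-positive at multidegree `n`,
every `n`. [this work] -/
theorem combPos_sahiE_ind_of_range_four {n : ℕ} (V : Fin 4 → Set (Set ι)) (hV : ∀ i, IsUpperSet (V i))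
    (U : Fin n → Set (Set ι)) (hrange : ∀ j, ∃ i, U j = V i)
    (h3 : ∀ φ : Fin 3 ↪ Fin 4, CombPos (fun _ : ι => 3) (fun p => sahiE (bernoulliWeight p) 3 (fun l => ind (V (φ l)))))
    (h4 : CombPos (fun _ : ι => 4) (fun p => sahiE (bernoulliWeight p) 4 (fun i => ind (V i)))) :
    CombPos (fun _ : ι => n) (fun p => sahiE (bernoulliWeight p) n (fun j => ind (U j))) := by
  have hU : ∀ j, IsUpperSet (U j) := fun j => by
    obtain ⟨i, hi⟩ := hrange j
    rw [hi]; exact hV i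
  refine combPos_sahiE_ind_of_range V U hU hrange fun j φ hj => ?_
  rcases embedding_four_cases φ hj with rfl | ⟨rfl, σ, hσ⟩
  · exact h3 φ
  · refine h4.congr fun p => ?_
    rw [← sahiE_comp_perm (bernoulliWeight p) 4 σ (fun i => ind (V i))]
    congr 1; funext l
    simp only [hσ, Fin.cast_eq_self]

/-! ### Unconditional all-order rows: families drawn from three events on a proved cubic stratum -/

section Unions

variable {A : Type} [Fintype A]

/-- **ALL ORDERS FOR FAMILIES DRAWN FROM THREE UNIONS OF INDEPENDENT INCREASING EVENTS.**  Let `(H_a)_{a ∈ A}` be increasing events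
determined by pairwise disjoint coordinate sets and `A_0, A_1, A_2 ⊆ A`.  Then for every `n` and every `s : Fin n → Fin 3` the family
`(⋃_{a ∈ A_{s(j)}} H_a)_{j<n}` has `E_n(μ_q)` comb-positive at multidegree `n` (cubic row: `…SahiCombVennThree`; standard axioms). [this work] -/
theorem combPos_sahiE_ind_unions_three (H : A → Set (Set ι)) (hHup : ∀ a, IsUpperSet (H a)) (D : A → Finset ι)
    (hD : ∀ a b, a ≠ b → Disjoint (D a) (D b)) (hH : ∀ a, DeterminedBy (H a) (↑(D a) : Set ι)) (𝒜 : Fin 3 → Finset A)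
    {n : ℕ} (s : Fin n → Fin 3) :
    CombPos (fun _ : ι => n) (fun q => sahiE (bernoulliWeight q) n (fun j => ind (⋃ a ∈ 𝒜 (s j), H a))) :=
  combPos_sahiE_ind_of_range_three (fun k => ⋃ a ∈ 𝒜 k, H a) (fun _ => isUpperSet_iUnion₂ fun a _ => hHup a)
    (fun j => ⋃ a ∈ 𝒜 (s j), H a) (fun j => ⟨s j, rfl⟩) (SahiCombVenn.combPos_sahiE_three_unions H D hD hH 𝒜)

/-- Law-level shadow: Sahi's `E_n(μ_q) ≥ 0`, every `n`, for every family drawn from three unions of independent increasing events,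
every product measure. [this work] -/
theorem sahiE_ind_nonneg_unions_three (q : ι → unitInterval) (H : A → Set (Set ι)) (hHup : ∀ a, IsUpperSet (H a)) (D : A → Finset ι)
    (hD : ∀ a b, a ≠ b → Disjoint (D a) (D b)) (hH : ∀ a, DeterminedBy (H a) (↑(D a) : Set ι)) (𝒜 : Fin 3 → Finset A)
    {n : ℕ} (s : Fin n → Fin 3) :
    0 ≤ sahiE (bernoulliWeight q) n (fun j => ind (⋃ a ∈ 𝒜 (s j), H a)) :=
  (combPos_sahiE_ind_unions_three H hHup D hD hH 𝒜 s).nonneg q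

end Unions

/-- **ALL ORDERS FOR FAMILIES DRAWN FROM THREE OR-EVENTS OF COORDINATES**: for all `S_0, S_1, S_2 ⊆ ι`, every `n` and every
`s : Fin n → Fin 3`, `q ↦ E_n(μ_q; (1_{ω ∩ S_{s(j)} ≠ ∅})_{j<n})` is comb-positive at multidegree `n` — e.g. `E_5` of
`(a∨b, a∨b, a∨c, b∨c, b∨c)` on the three-coin OR-triangle, the hard-core triple of every order-`3` stratum. [this work] -/
theorem combPos_sahiE_ind_or_three (S : Fin 3 → Finset ι) {n : ℕ} (s : Fin n → Fin 3) :
    CombPos (fun _ : ι => n) (fun q => sahiE (bernoulliWeight q) n (fun j => ind {ω : Set ι | ∃ i ∈ S (s j), i ∈ ω})) :=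
  combPos_sahiE_ind_of_range_three (fun k => {ω : Set ι | ∃ i ∈ S k, i ∈ ω})
    (fun _ _ _ hle ⟨i, hi, hiω⟩ => ⟨i, hi, hle hiω⟩)
    (fun j => {ω : Set ι | ∃ i ∈ S (s j), i ∈ ω}) (fun j => ⟨s j, rfl⟩) (SahiCombVenn.combPos_sahiE_three_or S)

/-- Law-level shadow: `E_n(μ_q; (1_{ω ∩ S_{s(j)} ≠ ∅})_j) ≥ 0` for every `n`, every `s`, every product measure. [this work] -/
theorem sahiE_ind_nonneg_or_three (q : ι → unitInterval) (S : Fin 3 → Finset ι) {n : ℕ} (s : Fin n → Fin 3) :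
    0 ≤ sahiE (bernoulliWeight q) n (fun j => ind {ω : Set ι | ∃ i ∈ S (s j), i ∈ ω}) :=
  (combPos_sahiE_ind_or_three S s).nonneg q

/-- **ALL ORDERS FROM A JUNTA-INTERSECTION TRIPLE** (prim-l12 P3's `…SahiCombJunta` row lifted): for increasing `U, A, B` with `A ∩ B`
determined by a set `W` of at most three coordinates, every family drawn from `{U, A, B}` has `E_n` comb-positive at multidegree `n`.
[this work] -/
theorem combPos_sahiE_ind_of_range_junta_three (W : Finset ι) (hW : W.card ≤ 3) {U A B : Set (Set ι)}
    (hU : IsUpperSet U) (hA : IsUpperSet A) (hB : IsUpperSet B) (hK : DeterminedBy (A ∩ B) (↑W : Set ι))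
    {n : ℕ} (s : Fin n → Fin 3) :
    CombPos (fun _ : ι => n) (fun p => sahiE (bernoulliWeight p) n (fun j => ind ((![U, A, B] : Fin 3 → Set (Set ι)) (s j)))) := by
  refine combPos_sahiE_ind_of_range_three ![U, A, B] (fun i => by fin_cases i <;> assumption) _ (fun j => ⟨s j, rfl⟩) ?_
  refine (SahiCombJunta.combPos_sahiE_three_of_inter_determinedBy_card_le_three W hW hU hA hB hK).congr fun p => ?_
  congr 1; funext i; fin_cases i <;> rfl

end SahiCombRange

end Summit.CriticalPhenomena.PercolationContinuityZ3.Theorems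

end
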